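import Literature.AlgebraicGeometry.HodgeTheory.AbelianVarietyHodgeFullnessOfUniformisation
import Literature.AlgebraicTopology.SingularHomology.CircleMapWinding
import Literature.AlgebraicTopology.SingularHomology.HurewiczOne
import Mathlib.Topology.Homotopy.Lifting
import HarnessLib

/-!
# Windings of loops in the real torus `(ℝ/ℤ)^ι`: lattice readings of torsion points and local constancy in families

Layer `Literature/Geometry/Kaehler`, namespace `Literature.Geometry.Kaehler.ComplexTorus`.  THEOREMS ONLY (no definition, no
named fact, no instance).  Generic leaf (E1) of the cell `hodgecm-mathlib` (U)-lane node U-e, engine (E2-core) «torsion readings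
against a flat frame are constant» (road (b-H′): only DISCRETE data transported).

For the torus `T = ComplexTorus Φ = (ℝ/ℤ)^ι` with canonical classes `ξₐ = (t ↦ tₐ)^*θ ∈ H¹(T; ℚ)` (★ `latticeClass`,
Lange (2023) Lemma 1.1.17 (a): `H¹(X, ℤ) = Hom(Λ, ℤ)`) and a loop `ℓ` in `T`, the **`a`-th winding** of `ℓ` is the integer
`ϑ(ℓₐ)` = winding cochain of the coordinate loop `ℓₐ = (t ↦ tₐ) ∘ ℓ` of `ℝ/ℤ` (★ `windingCochain`, Hatcher Thm. 1.7), i.e. the lift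
increment `ℓ̂ₐ(1) − ℓ̂ₐ(0)` of ANY continuous real lift (★ `liftIncrement_eq_of_lift`).

* `kroneckerPairing_circleClass_loopClass_ringCast` — `⟨θ, h(p)⟩ = ϑ(p)` over any commutative coefficient ring (★
  `kroneckerPairing_circleClass_loopClass` is the case `ℤ`);
* `kroneckerPairing_latticeCircle_loopClass` (any coefficient ring `R`) / `kroneckerPairing_latticeClass_loopClass` (`R = ℚ`, ★
  `latticeClass`) — **`⟨ξₐ, h(ℓ)⟩ = ϑ(ℓₐ)`**: the Kronecker pairing of `ξₐ = (t ↦ tₐ)^*θ` with the Hurewicz class of a loop is its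
  `a`-th winding (naturality ★ `kroneckerPairing_map` / ★ `map_loopClass`);
* `windingCochain_coord_eq_of_lift` — the winding is computed by any real lift of the coordinate loop;
* `windingCochain_nsmul_path_of_torsion` — **the lattice reading of an `N`-torsion point**: for a path `q` from `0` to the
  `N`-torsion point `[w/N]` (`w ∈ ℤ^ι`), the loop `N • q` has `a`-th winding `≡ wₐ (mod N)` (its lift from `0` ends at `w/N + m`);
* `exists_nhds_windingCochain_eq` — **LOCAL CONSTANCY IN FAMILIES**: for a continuous family of loops `ℓ_x` (`x ∈ O`, as a
  continuous map `O × [0,1] → T` with `ℓ_x(0) = ℓ_x(1)`) the `a`-th winding is locally constant in `x` (homotopy lifting for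
  `ℝ → ℝ/ℤ`, Mathlib `IsCoveringMap.liftHomotopy`, after translating the base points to `0`; Hatcher Prop. 1.30), hence constant on
  preconnected parameter spaces (`windingCochain_eq_of_preconnectedSpace`).
HC_CM is proved only modulo the 7 printed citations until rung 0 closes.

## References
* [HatcherAT2002] A. Hatcher, *Algebraic Topology*, CUP 2002, Thm. 1.7 (p. 29), Prop. 1.30 (p. 60), §2.A Thm. 2A.1 (p. 166), §3.1
  p. 198, §3.2 Example 3.16 (p. 216).
* [Lange2023AbelianVarietiesComplex] H. Lange, *Abelian Varieties over the Complex Numbers* (2023), §1.1.3 (1.3)–(1.4) (pp. 13–14)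
  and Lemma 1.1.17 (a) (p. 14).
-/

noncomputable section

open Set Function unitInterval Topology
open Literature.AlgebraicTopology.SingularHomology Literature.AlgebraicTopology.SingularHomology.SingularSimplex
  Literature.AlgebraicTopology.SingularHomology.singularChainComplex
  Literature.AlgebraicTopology.SingularHomology.singularCochainComplex
open Literature.AlgebraicGeometry.HodgeTheory (latticeClass latticeCircle)

namespace Literature.Geometry.Kaehler

namespace ComplexTorus

/-! ### `⟨θ, h(p)⟩ = ϑ(p)` over any coefficient ring -/

/-- **`⟨θ, h(p)⟩ = ϑ(p)`** for the generator `θ ∈ H¹(ℝ/ℤ; R)` and the Hurewicz class of a loop `p` of `ℝ/ℤ`, over any commutative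
coefficient ring `R` (evaluation of the winding cocycle on the one-simplex cycle of `p`; ★ `kroneckerPairing_circleClass_loopClass` is
`R = ℤ`). [cite: HatcherAT2002, §3.1 p. 198 and Thm. 1.7 (p. 29)] -/
theorem kroneckerPairing_circleClass_loopClass_ringCast (R : Type) [CommRing R] {a : UnitAddCircle} (p : Path a a) :
    kroneckerPairing R R UnitAddCircle 1 (circleClass R) (loopClass R R (1 : R) p) = (windingCochain (ofPath p) : R) := by
  set K := singularChainComplex R R UnitAddCircle
  have hz : K.d 1 0 (single (R := R) (ofPath p) (1 : R)) = 0 := by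
    rw [d_single_ofPath, sub_self]
  let zc : cycles R R UnitAddCircle 1 := K.cyclesMk (single (R := R) (ofPath p) (1 : R)) 0 (by simp) hz
  have hzc : iCycles R R UnitAddCircle 1 zc =
      ∑ i ∈ (Finset.univ : Finset Unit), single (R := R) ((fun _ : Unit => ofPath p) i)
        ((fun _ : Unit => (1 : R)) i) := by
    rw [Finset.univ_unique, Finset.sum_singleton]
    exact K.i_cyclesMk _ 0 (by simp) hz
  have hcls : loopClass R R (1 : R) p = K.homologyπ 1 zc :=
    homologyCls_eq_homologyπ_cyclesMk _ _ 0 (by simp) hz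
  rw [hcls, circleClass, kroneckerPairing_π_single Finset.univ (fun _ : Unit => ofPath p)
    (fun _ : Unit => (1 : R)) (circleCocycle R) zc hzc, Finset.univ_unique, Finset.sum_singleton,
    iCocycles_circleCocycle, circleCochain_apply, smul_eq_mul, mul_one]

/-! ### Windings of loops in the torus -/

variable {ι : Type} {E : Type} [NormedAddCommGroup E] [NormedSpace ℂ E] (Φ : (ι → ℝ) ≃L[ℝ] E)

/-- **`⟨(t ↦ tₐ)^*θ, h(ℓ)⟩ = ϑ(ℓₐ)` over any coefficient ring**: the Kronecker pairing of the pulled-back generator of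
`H¹(ℝ/ℤ; R)` along the `a`-th coordinate with the Hurewicz class of a loop `ℓ` is the winding number of the coordinate loop
`ℓₐ = (t ↦ tₐ) ∘ ℓ`. [cite: Lange2023AbelianVarietiesComplex, §1.1.3 Lemma 1.1.17 (a) (p. 14)] [cite: HatcherAT2002, §3.1 p. 198] -/
theorem kroneckerPairing_latticeCircle_loopClass (R : Type) [CommRing R] (a : ι) {t : ComplexTorus Φ} (ℓ : Path t t) :
    kroneckerPairing R R (ComplexTorus Φ) 1 (singularCohomology.map R R (latticeCircle Φ a) 1 (circleClass R))
        (loopClass R R (1 : R) ℓ) = (windingCochain (ofPath (ℓ.map (latticeCircle Φ a).continuous)) : R) := by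
  rw [kroneckerPairing_map, map_loopClass]
  exact kroneckerPairing_circleClass_loopClass_ringCast R _

/-- **`⟨ξₐ, h(ℓ)⟩ = ϑ(ℓₐ)`**: the Kronecker pairing of the canonical class `ξₐ ∈ H¹((ℝ/ℤ)^ι; ℚ)` (★ `latticeClass`) with the
Hurewicz class of a loop `ℓ` is the winding number of its `a`-th coordinate loop (Lange (2023) Lemma 1.1.17 (a): `ξₐ` is the
functional «`a`-th coordinate» on `Λ = H₁`). [cite: Lange2023AbelianVarietiesComplex, §1.1.3 Lemma 1.1.17 (a) (p. 14)] [cite: HatcherAT2002, §3.1 p. 198] -/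
theorem kroneckerPairing_latticeClass_loopClass (a : ι) {t : ComplexTorus Φ} (ℓ : Path t t) :
    kroneckerPairing ℚ ℚ (ComplexTorus Φ) 1 (latticeClass Φ a) (loopClass ℚ ℚ (1 : ℚ) ℓ) =
      (windingCochain (ofPath (ℓ.map (latticeCircle Φ a).continuous)) : ℚ) :=
  kroneckerPairing_latticeCircle_loopClass Φ ℚ a ℓ

/-- **The winding is computed by any real lift**: if `L : [0,1] → ℝ` is continuous with `L(s) mod ℤ = ℓ(s)ₐ`, then
`ϑ(ℓₐ) = L(1) − L(0)`. [cite: HatcherAT2002, Prop. 1.30 (p. 60) and Thm. 1.7] -/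
theorem windingCochain_coord_eq_of_lift (a : ι) {t : ComplexTorus Φ} (ℓ : Path t t) (L : C(unitInterval, ℝ))
    (hL : ∀ s, ((L s : ℝ) : UnitAddCircle) = ℓ s a) :
    (windingCochain (ofPath (ℓ.map (latticeCircle Φ a).continuous)) : ℝ) = L 1 - L 0 := by
  rw [← liftIncrement_loop_eq_windingCochain]
  exact liftIncrement_eq_of_lift _ L hL

/-- **The lattice reading of an `N`-torsion point through windings.**  Let `w ∈ ℤ^ι`, `N ≥ 1`, and let `q` be ANY path in the torus
from `0` to the `N`-torsion point `[w/N]`.  Then the loop `N • q` (based at `0`) has `a`-th winding `≡ wₐ (mod N)`: the lift of `qₐ`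
from `0` ends at `wₐ/N + m` with `m ∈ ℤ`, so `N • qₐ` winds `wₐ + N m` times. [cite: HatcherAT2002, Thm. 1.7 (p. 29)]
[cite: Lange2023AbelianVarietiesComplex, §1.1.3 (1.3)–(1.4) (pp. 13–14)] -/
theorem windingCochain_nsmul_path_of_torsion (a : ι) (N : ℕ) (hN : 0 < N) (w : ι → ℤ)
    (q : Path (0 : ComplexTorus Φ) (proj Φ fun i ↦ (w i : ℝ) / N)) {t : ComplexTorus Φ} (ℓ : Path t t)
    (hℓ : ∀ s, ℓ s = N • q s) :
    ((windingCochain (ofPath (ℓ.map (latticeCircle Φ a).continuous)) : ZMod N) = (w a : ZMod N)) := by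
  -- the lift of the coordinate path `qₐ` from `0`
  set qa : Path ((0 : ComplexTorus Φ) a) ((proj Φ fun i ↦ (w i : ℝ) / N) a) :=
    q.map (latticeCircle Φ a).continuous with hqa
  have hstart : pathLift qa 0 = 0 := by
    rw [pathLift_zero]
    exact circleRep_zero
  -- its endpoint is `wₐ/N` up to an integer
  obtain ⟨m, hm⟩ : ∃ m : ℤ, pathLift qa 1 = (w a : ℝ) / N + m := by
    have h := coe_pathLift qa 1
    rw [qa.target] at h
    exact exists_int_eq_sub_of_coe_eq (h.trans (proj_apply Φ _ a))
  -- `N · q̂ₐ` lifts the coordinate loop `(N • q)ₐ`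
  set L : C(unitInterval, ℝ) := ⟨fun s ↦ (N : ℝ) * pathLift qa s, continuous_const.mul (pathLift qa).continuous⟩ with hLdef
  have hL : ∀ s, ((L s : ℝ) : UnitAddCircle) = ℓ s a := fun s ↦ by
    have h1 : ((L s : ℝ) : UnitAddCircle) = N • ((pathLift qa s : ℝ) : UnitAddCircle) := by
      rw [← AddCircle.coe_nsmul, nsmul_eq_mul]
      rfl
    rw [h1, coe_pathLift, hℓ s]
    rfl
  have hwind := windingCochain_coord_eq_of_lift Φ a ℓ L hL
  have hval : (windingCochain (ofPath (ℓ.map (latticeCircle Φ a).continuous)) : ℝ) = ((w a + N * m : ℤ) : ℝ) := by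
    rw [hwind]
    change (N : ℝ) * pathLift qa 1 - (N : ℝ) * pathLift qa 0 = _
    rw [hstart, hm]
    have hN' : (N : ℝ) ≠ 0 := by exact_mod_cast hN.ne'
    field_simp
    push_cast
    ring
  have hint : windingCochain (ofPath (ℓ.map (latticeCircle Φ a).continuous)) = w a + N * m := by
    exact_mod_cast hval
  rw [hint]
  push_cast
  simp

/-! ### Local constancy of windings in continuous families of loops -/

variable {O : Type} [TopologicalSpace O]

/-- **LOCAL CONSTANCY OF WINDINGS IN FAMILIES.**  Let `ℓ : O × [0,1] → (ℝ/ℤ)^ι` be continuous with `ℓ(x, 0) = ℓ(x, 1)` for every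
`x` (a continuous family of loops, base points allowed to move).  Then every `x₀` has a neighbourhood on which the `a`-th winding of
`ℓ_x` is that of `ℓ_{x₀}`: translate the base points to `0` and lift the family `(x, s) ↦ ℓ(x, s)ₐ − ℓ(x, 0)ₐ` through `ℝ → ℝ/ℤ`
starting from the zero lift (homotopy lifting, Hatcher Prop. 1.30); the endpoint `Λ(x, 1)` is a continuous INTEGER-valued function.
[cite: HatcherAT2002, Prop. 1.30 (p. 60) and Thm. 1.7 (p. 29)] -/
theorem exists_nhds_windingCochain_eq (a : ι) (ℓ : C(O × unitInterval, ComplexTorus Φ)) (hℓ : ∀ x, ℓ (x, 0) = ℓ (x, 1))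
    (γ : ∀ x : O, Path (ℓ (x, 0)) (ℓ (x, 0))) (hγ : ∀ x s, γ x s = ℓ (x, s)) (x₀ : O) :
    ∀ᶠ x in 𝓝 x₀, windingCochain (ofPath ((γ x).map (latticeCircle Φ a).continuous)) =
      windingCochain (ofPath ((γ x₀).map (latticeCircle Φ a).continuous)) := by
  -- the translated coordinate family `H(s, x) = ℓ(x, s)ₐ − ℓ(x, 0)ₐ`, based at `0`
  set H : C(unitInterval × O, UnitAddCircle) :=
    ⟨fun p ↦ ℓ (p.2, p.1) a - ℓ (p.2, 0) a,
      ((continuous_apply a).comp (ℓ.continuous.comp (continuous_snd.prodMk continuous_fst))).sub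
        ((continuous_apply a).comp (ℓ.continuous.comp (continuous_snd.prodMk continuous_const)))⟩ with hHdef
  have hH0 : ∀ x, H (0, x) = (((0 : C(O, ℝ)) x : ℝ) : UnitAddCircle) := fun x ↦ by
    change ℓ (x, 0) a - ℓ (x, 0) a = (((0 : ℝ)) : UnitAddCircle)
    rw [sub_self, AddCircle.coe_zero]
  -- its lift starting from the zero lift
  set Λ := isCoveringMap_coe_unitAddCircle.liftHomotopy H (0 : C(O, ℝ)) hH0 with hΛdef
  have hΛlift : ∀ s x, ((Λ (s, x) : ℝ) : UnitAddCircle) = H (s, x) := fun s x ↦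
    congrFun (isCoveringMap_coe_unitAddCircle.liftHomotopy_lifts H (0 : C(O, ℝ)) hH0) (s, x)
  have hΛ0 : ∀ x, Λ (0, x) = 0 := fun x ↦
    isCoveringMap_coe_unitAddCircle.liftHomotopy_zero H (0 : C(O, ℝ)) hH0 x
  -- the winding of `ℓ_x` is `Λ(1, x)`
  have hwind : ∀ x, (windingCochain (ofPath ((γ x).map (latticeCircle Φ a).continuous)) : ℝ) = Λ (1, x) := by
    intro x
    -- the lift `s ↦ Λ(s, x) + (a lift of the base point)` of the coordinate loop of `ℓ_x`
    set Lx : C(unitInterval, ℝ) := ⟨fun s ↦ Λ (s, x) + circleRep (ℓ (x, 0) a),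
      (Λ.continuous.comp (continuous_id.prodMk continuous_const)).add continuous_const⟩ with hLx
    have hLxlift : ∀ s, ((Lx s : ℝ) : UnitAddCircle) = (γ x) s a := fun s ↦ by
      change (((Λ (s, x) + circleRep (ℓ (x, 0) a) : ℝ)) : UnitAddCircle) = _
      rw [AddCircle.coe_add, hΛlift, coe_circleRep, hγ]
      change ℓ (x, s) a - ℓ (x, 0) a + ℓ (x, 0) a = ℓ (x, s) a
      abel
    rw [windingCochain_coord_eq_of_lift Φ a (γ x) Lx hLxlift]
    change Λ (1, x) + circleRep (ℓ (x, 0) a) - (Λ (0, x) + circleRep (ℓ (x, 0) a)) = Λ (1, x)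
    rw [hΛ0]
    ring
  -- `Λ(1, ·)` is continuous and integer-valued, hence locally constant
  have hint : ∀ x, ∃ k : ℤ, Λ (1, x) = k := fun x ↦ by
    have h1 : ((Λ (1, x) : ℝ) : UnitAddCircle) = ((0 : ℝ) : UnitAddCircle) := by
      rw [hΛlift, AddCircle.coe_zero]
      change ℓ (x, 1) a - ℓ (x, 0) a = 0
      rw [← hℓ x, sub_self]
    obtain ⟨k, hk⟩ := exists_int_eq_sub_of_coe_eq h1
    exact ⟨k, by rw [hk, zero_add]⟩
  have hcont : Continuous fun x ↦ Λ (1, x) := Λ.continuous.comp (continuous_const.prodMk continuous_id)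
  -- continuity at `x₀`: `|Λ(1,x) − Λ(1,x₀)| < 1` near `x₀`, and both are integers
  have hnear : ∀ᶠ x in 𝓝 x₀, dist (Λ (1, x)) (Λ (1, x₀)) < 1 :=
    (Metric.tendsto_nhds.1 (hcont.tendsto x₀)) 1 one_pos
  filter_upwards [hnear] with x hx
  obtain ⟨k, hk⟩ := hint x
  obtain ⟨k₀, hk₀⟩ := hint x₀
  have hkk : k = k₀ := by
    rw [hk, hk₀, Real.dist_eq] at hx
    have : |(k : ℝ) - k₀| < 1 := hx
    have h' : |((k - k₀ : ℤ) : ℝ)| < 1 := by push_cast; exact this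
    rw [← Int.cast_abs] at h'
    have h'' : |k - k₀| < 1 := by exact_mod_cast h'
    have : |k - k₀| = 0 := by
      have := abs_nonneg (k - k₀)
      omega
    rw [abs_eq_zero, sub_eq_zero] at this
    exact this
  have e := (hwind x).trans (by rw [hk, hkk, ← hk₀, ← hwind x₀])
  exact_mod_cast e

/-- **Windings are constant in continuous families over preconnected parameter spaces.**
[cite: HatcherAT2002, Prop. 1.30 (p. 60)] -/
theorem windingCochain_eq_of_preconnectedSpace [PreconnectedSpace O] (a : ι) (ℓ : C(O × unitInterval, ComplexTorus Φ))
    (hℓ : ∀ x, ℓ (x, 0) = ℓ (x, 1)) (γ : ∀ x : O, Path (ℓ (x, 0)) (ℓ (x, 0))) (hγ : ∀ x s, γ x s = ℓ (x, s)) (x x' : O) :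
    windingCochain (ofPath ((γ x).map (latticeCircle Φ a).continuous)) =
      windingCochain (ofPath ((γ x').map (latticeCircle Φ a).continuous)) := by
  -- a locally constant function on a preconnected space is constant
  have hlc : IsLocallyConstant fun x : O ↦
      windingCochain (ofPath ((γ x).map (latticeCircle Φ a).continuous)) := by
    refine (IsLocallyConstant.iff_eventually_eq _).2 fun x₀ ↦ ?_
    exact exists_nhds_windingCochain_eq Φ a ℓ hℓ γ hγ x₀
  exact hlc.apply_eq_of_preconnectedSpace x x'

end ComplexTorus

end Literature.Geometry.Kaehler

end
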